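import Summits.BirchSwinnertonDyer.BirchSwinnertonDyer.Theorems.EisensteinPrimesMazurMCOnX1RankZeroInterludeRoadBGL1Reduction
import Summits.BirchSwinnertonDyer.BirchSwinnertonDyer.Theorems.EisensteinPrimesMazurMCOnX1RankZeroInterludeDefs
import Literature.NumberTheory.EllipticCurves.Castella2018.AnticyclotomicSelmer
import Literature.NumberTheory.EllipticCurves.GreenbergVatsal2000.GreenbergSelmerGroups
import Literature.NumberTheory.IwasawaTheory.ClassicalMuVanishesUnramifiedClasses
import Summits.BirchSwinnertonDyer.BirchSwinnertonDyer.Theorems.TwoAdicConverseOrdLambdaHalfAtTwoGreenbergTameQuotientFinite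
import Summits.BirchSwinnertonDyer.BirchSwinnertonDyer.Theorems.EisensteinPrimesMazurMCOnX1RankZeroInterludeRoadBResidueP
import Literature.NumberTheory.EllipticCurves.SelmerCorankProofs
import HarnessLib

/-!
# Crux `MazurMCOnX1RankZero` (item stmt-BirchSwinnertonDyer-19035), line `interlude_with_torsion`, road B (B3) for CONTINUOUS actions:
# [P23] (tame places) DISCHARGED, [P1] DISCHARGED for rational kernels from two named facts, and the junk-free reduction
# `ResidualGL1FinitenessOddCont ⟸ [P1]-cont ∧ [Cv]-cont` (companion of `…InterludeRoadBGL1Reduction`)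

Cell `bsd-eis` (host `run/shared/lean/pub/bsd-eis/`), LEAD `cruxlead-19035` (g0); `--supports` stmt-BirchSwinnertonDyer-19035 as a
HELPER. Second half of the ideator bsd-idea-11 g16's tree-ready workfile `Cruxes/MazurMCOnX1RankZero/Lines/interlude_roadB_GL1Reduction_treeready_idea11g16.lean`
(rev 5, commit 42604aa1cca4; mathematics by that seat, verbatim; critic A69/A71–A73 PASS), split at the 400-line limit. Sections:
§TameContinuous — [P23] for CONTINUOUS actions is a THEOREM (`finite_quotient_unramifiedAbove_of_continuous`, from the cell bsd-2adic's
kernel theorems `TwoAdicConverseOrdLambdaHalfAtTwoGreenbergTameQuotientFinite` p663165); §TrivialAction — [P1] for a TRIVIAL `Γ_ℚ`-action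
(rational kernels) from the two named facts `IwasawaTheory.ferreroWashington1979_classicalMuVanishes` + `…classicalMuVanishes_finite_unramifiedClasses`;
§ContinuousVariant — `@[conjecture] def GL1InputUnramifiedCont / GL1InputSplitPrimeCont`, `residualGL1FinitenessOddCont_of_inputs :
[P1]-cont → [Cv]-cont → ResidualGL1FinitenessOddCont` (two inputs; the tame one eliminated), `ResidualGL1FinitenessOddContRat` and
`residualGL1FinitenessOddContRat_of_namedFacts : FW → U → [Cv]-cont → (B3)-cont for rational kernels`. HONEST FRAMING: the `@[conjecture]` inputs are
displayed hypotheses (class field theory / Ferrero–Washington / Brumer–Leopoldt; not theorems of the tree); nothing about BSD, Mazur's main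
conjecture or IMC2 is asserted; the registered stub `stub_residualGL1FinitenessOdd` is NOT closed by this file.
[cite: GreenbergLNM1716, §5, Lemma 5.9, proof of Prop. 5.10 (pp. 143–144)] [cite: FerreroWashington1979, Theorem] [cite: Washington1997, §13.1, §13.3, §13.5]
[cite: Brumer1967, Theorem] [cite: GreenbergVatsal2000, §2]
-/

noncomputable section

namespace Summit.BirchSwinnertonDyer.BirchSwinnertonDyer.Theorems.InterludeWithTorsion.RoadBHelpers

open AddSubgroup

universe u v

section TameContinuous

/-! ## [P23] DISCHARGED for CONTINUOUS actions (generation 16): the cell `bsd-2adic` kernel theorems (p663165, there for TRIVIAL action,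
any `p`) generalise verbatim to continuous `Γ_K`-actions; for the cyclotomic tower no place splits completely
(`TwoAdicGreenbergCotorsion.not_decomp_le_kerSubgroup_of_isCyclotomic`). What remains of [P23] as typed (`GL1InputTame`, no continuity
binder) is the junk case of a NON-continuous action on `M` (`#M = p`), where every continuous cocycle vanishes (the values of a continuous
cocycle have open stabilisers; an `H`-stable subgroup of a group of order `p` is `0` or `M`) — not typed here. -/

open Summit.BirchSwinnertonDyer.Rank1Residual.X11b Summit.BirchSwinnertonDyer.Rank1Residual.X11b.AcSelmer
  Summit.BirchSwinnertonDyer.Rank1Residual.X2.ResidualDevissageModules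
  Summit.BirchSwinnertonDyer.Rank1Residual.Iwasawa
  Summit.BirchSwinnertonDyer.BirchSwinnertonDyer.Theorems.UniversalToricDescentResidualSelmerFinite
  Summit.BirchSwinnertonDyer.BirchSwinnertonDyer.Theorems.SelmerAcQuotientCorankLeGeneric
  Summit.BirchSwinnertonDyer.BirchSwinnertonDyer.Theorems.TwoAdicGreenbergCotorsion
  Field Literature.NumberTheory.EllipticCurves Literature.NumberTheory.EllipticCurves.GreenbergSelmer
  Literature.NumberTheory.EllipticCurves.GreenbergVatsal2000 Literature.NumberTheory.GaloisRepresentations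
  NumberField IsDedekindDomain WeierstrassCurve

variable {K : Type} [Field K] [NumberField K] {p : ℕ} [Fact p.Prime] (κ : ZpExtension K p)
  (M : Type) [AddCommGroup M] [DistribMulAction (absoluteGaloisGroup K) M] [TopologicalSpace M] [DiscreteTopology M]

/-- **`H¹(Gal(K̄/K_∞) ⊓ D_v, M)` is finite** for a finite discrete `Γ_K`-module `M` of `p`-power order with CONTINUOUS action
(generation 16: the cell `bsd-2adic` theorem `TwoAdicGreenbergCotorsion.finite_subgroupH1_inf_decomp_of_trivial`, p663165, verbatim with
«trivial» weakened to «continuous» — triviality was used there only to get continuity of the local action), at a place `v ∤ p` whose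
decomposition group is not inside `ker κ`: the local group `Gal(K̄_v/K_{∞,η})` surjects onto `ker κ ⊓ D_v`, `H¹` of it is finite by
`Iwasawa.NonsplitTower.finite_subgroupH1_and_natCard_le` (`#M` prime to the residue characteristic; any continuous action), and
inflation along a surjection is injective. [cite: GreenbergLNM1716, §3 Lemma 3.3 (proof, p. 87)] [cite: GreenbergVatsal2000, §2 Prop. (2.4)] -/
theorem finite_subgroupH1_inf_decomp_of_continuous [Finite M] (hM : ∃ k : ℕ, Nat.card M = p ^ k)
    (hcontK : ∀ m : M, Continuous fun σ : absoluteGaloisGroup K ↦ σ • m)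
    {v : HeightOneSpectrum (𝓞 K)} (hpv : (p : 𝓞 K) ∉ v.asIdeal) (hv : ¬ (decomp v ≤ κ.kerSubgroup)) :
    Finite (Literature.NumberTheory.EllipticCurves.subgroupH1 (κ.kerSubgroup ⊓ decomp v) M) := by
  have hp : p.Prime := Fact.out
  -- the local action through the chosen embedding (a local instance of this proof only); continuous
  letI : DistribMulAction (absoluteGaloisGroup (v.adicCompletion K)) M :=
    DistribMulAction.compHom _ (absGaloisRestrict K (v.adicCompletion K)).toMonoidHom
  have hcont : ∀ b : M, Continuous fun σ : absoluteGaloisGroup (v.adicCompletion K) ↦ σ • b := fun b ↦ by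
    have : (fun σ : absoluteGaloisGroup (v.adicCompletion K) ↦ σ • b) =
        (fun σ : absoluteGaloisGroup K ↦ σ • b) ∘ (absGaloisRestrict K (v.adicCompletion K)) := rfl
    rw [this]
    exact (hcontK b).comp (absGaloisRestrict K (v.adicCompletion K)).continuous_toFun
  -- `v` not split completely: some `σ ∈ Γ_{K_v}` restricts outside `ker κ`
  have hns : ∃ σ : absoluteGaloisGroup (v.adicCompletion K),
      σ ∉ localSubgroup κ.kerSubgroup (v.adicCompletion K) := by
    by_contra hall
    refine hv fun g hg ↦ ?_
    obtain ⟨σ, rfl⟩ := (mem_decomp_iff v g).mp hg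
    have hσ : σ ∈ localSubgroup κ.kerSubgroup (v.adicCompletion K) :=
      not_not.mp fun h ↦ hall ⟨σ, h⟩
    have h := (mem_localSubgroup_iff κ.kerSubgroup (v.adicCompletion K) σ).mp hσ
    rwa [resGal_eq_absGaloisRestrict] at h
  -- `#M = p^k` is prime to the residue characteristic; `M` is `p^k`-torsion
  obtain ⟨k, hk⟩ := hM
  have hℓ := ringChar_residueField_prime (F := v.adicCompletion K)
  have hne := v.ringChar_residueField_adicCompletion_ne hpv
  have hB : ∃ k : ℕ, ∀ b : M, p ^ k • b = 0 := ⟨k, fun b ↦ by rw [← hk]; exact card_nsmul_eq_zero'⟩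
  have hfin := (NonsplitTower.finite_subgroupH1_and_natCard_le κ hpv hns hB (by
    rw [hk]
    exact ((Nat.coprime_primes hp hℓ).2 (Ne.symm hne)).pow_left k) hcont).1
  -- inflation along `Gal(K̄_v/K_{∞,η}) ↠ ker κ ⊓ D_v`
  let θ : localSubgroup κ.kerSubgroup (v.adicCompletion K) →ₜ* (κ.kerSubgroup ⊓ decomp v :
      Subgroup (absoluteGaloisGroup K)) :=
    { toFun := fun x ↦ ⟨absGaloisRestrict K (v.adicCompletion K) x, Subgroup.mem_inf.mpr ⟨by
          have h := (mem_localSubgroup_iff κ.kerSubgroup (v.adicCompletion K) x.1).mp x.2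
          rwa [resGal_eq_absGaloisRestrict] at h, (mem_decomp_iff v _).mpr ⟨x, rfl⟩⟩⟩
      map_one' := Subtype.ext (by simp)
      map_mul' := fun x y ↦ Subtype.ext (by simp)
      continuous_toFun :=
        ((absGaloisRestrict K (v.adicCompletion K)).continuous_toFun.comp
          continuous_subtype_val).subtype_mk _ }
  have hθ : Function.Surjective θ := by
    rintro ⟨g, hg⟩
    obtain ⟨hgH, hgD⟩ := Subgroup.mem_inf.mp hg
    obtain ⟨σ, rfl⟩ := (mem_decomp_iff v g).mp hgD
    have hσ : σ ∈ localSubgroup κ.kerSubgroup (v.adicCompletion K) := by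
      rw [mem_localSubgroup_iff, resGal_eq_absGaloisRestrict]; exact hgH
    exact ⟨⟨σ, hσ⟩, rfl⟩
  exact Finite.of_injective _ (resH1Hom_injective_of_surjective θ hθ fun _ _ ↦ rfl)


/-- **[P23] for CONTINUOUS actions is a theorem** (generation 16; = `TwoAdicGreenbergCotorsion.finite_quotient_iInf_unramifiedKer_of_not_decomp_le`
of cell `bsd-2adic`, p663165, verbatim with «trivial» weakened to «continuous»): for a `ℤ_p`-extension `κ` of a number field `K`, a place
`v ∤ p` with `D_v ⊄ ker κ`, and a finite discrete `Γ_K`-module `M` of `p`-power order with continuous action,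
`H¹(ker κ, M) ⧸ ⨅_σ conj_σ⁻¹(unramifiedKer (ker κ) M v)` is FINITE (signature map to `(H¹(ker κ ⊓ D_v, M))^{p^c}`, kernel locally
trivial at every place above `v`, hence unramified there). [cite: GreenbergVatsal2000, §2 Prop. (2.4)] [cite: CasselsFrohlich1967, Ch. I §8 Thm. 1, Cor. 3] -/
theorem finite_quotient_iInf_unramifiedKer_of_continuous [Finite M] (hM : ∃ k : ℕ, Nat.card M = p ^ k)
    (hcontK : ∀ m : M, Continuous fun σ : absoluteGaloisGroup K ↦ σ • m)
    {v : HeightOneSpectrum (𝓞 K)} (hpv : (p : 𝓞 K) ∉ v.asIdeal) (hv : ¬ (decomp v ≤ κ.kerSubgroup)) :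
    Finite (Literature.NumberTheory.EllipticCurves.subgroupH1 κ.kerSubgroup M ⧸
      ⨅ σ : absoluteGaloisGroup K, (unramifiedKer κ.kerSubgroup M v).comap
        (Literature.NumberTheory.EllipticCurves.conjH1 κ.kerSubgroup M σ)) := by
  haveI := finite_subgroupH1_inf_decomp_of_continuous κ M hM hcontK hpv hv
  set U : AddSubgroup (Literature.NumberTheory.EllipticCurves.subgroupH1 κ.kerSubgroup M) :=
    ⨅ σ : absoluteGaloisGroup K, (unramifiedKer κ.kerSubgroup M v).comap
      (Literature.NumberTheory.EllipticCurves.conjH1 κ.kerSubgroup M σ)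
  obtain ⟨c, hc⟩ := forall_resOfLe_conjH1_eq_zero_of_reps (κ := κ) (M := M) v hv
  -- representatives `τ i` with `κ (τ i) = i`
  have hτ' : ∀ i : ℕ, ∃ τ : absoluteGaloisGroup K, κ τ = Multiplicative.ofAdd ((i : ℕ) : ℤ_[p]) :=
    fun i ↦ κ.surjective _
  choose τ hτ using hτ'
  -- the signature map
  let res := resOfLe M (inf_le_left : κ.kerSubgroup ⊓ decomp v ≤ κ.kerSubgroup)
  let Ψ : Literature.NumberTheory.EllipticCurves.subgroupH1 κ.kerSubgroup M →+
      (Fin (p ^ c) → Literature.NumberTheory.EllipticCurves.subgroupH1 (κ.kerSubgroup ⊓ decomp v) M) :=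
    AddMonoidHom.pi fun i ↦ res.comp (Literature.NumberTheory.EllipticCurves.conjH1 κ.kerSubgroup M (τ i))
  -- its kernel is unramified at every place above `v`
  have hker : Ψ.ker ≤ U := by
    intro y hy
    rw [AddMonoidHom.mem_ker] at hy
    have hy' : ∀ i, i < p ^ c →
        res (Literature.NumberTheory.EllipticCurves.conjH1 κ.kerSubgroup M (τ i) y) = 0 := fun i hi ↦
      congrFun hy ⟨i, hi⟩
    have hall := hc τ hτ y hy'
    simp only [U, AddSubgroup.mem_iInf, AddSubgroup.mem_comap]
    intro σ
    exact awayKer_le_unramifiedKer κ.kerSubgroup M v ((AddMonoidHom.mem_ker).mpr (hall σ))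
  -- finite index
  haveI : Finite (Literature.NumberTheory.EllipticCurves.subgroupH1 κ.kerSubgroup M ⧸ Ψ.ker) :=
    Finite.of_injective (QuotientAddGroup.kerLift Ψ) (QuotientAddGroup.kerLift_injective Ψ)
  haveI : Ψ.ker.FiniteIndex := AddSubgroup.finiteIndex_of_finite_quotient
  haveI : U.FiniteIndex := AddSubgroup.finiteIndex_of_le hker
  exact AddSubgroup.finite_quotient_of_finiteIndex


/-- **[P23] (`GL1InputTame`) for CONTINUOUS actions, cyclotomic tower**: `H¹(K_∞, M) ⧸ unramifiedAbove v` is finite for `v ∤ p`,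
`#M = p`. [cite: GreenbergVatsal2000, §2 Prop. (2.4)] -/
theorem finite_quotient_unramifiedAbove_of_continuous (hκ : κ.IsCyclotomic) (hcard : Nat.card M = p)
    (hcontK : ∀ m : M, Continuous fun σ : absoluteGaloisGroup K ↦ σ • m)
    (v : HeightOneSpectrum (𝓞 K)) (hpv : ((p : ℕ) : 𝓞 K) ∉ v.asIdeal) :
    Finite (Literature.NumberTheory.EllipticCurves.subgroupH1 κ.kerSubgroup M ⧸ unramifiedAbove κ.kerSubgroup M v) := by
  haveI : Finite M := Nat.finite_of_card_ne_zero (by rw [hcard]; exact (Fact.out : p.Prime).ne_zero)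
  exact finite_quotient_iInf_unramifiedKer_of_continuous κ M ⟨1, by rw [hcard, pow_one]⟩ hcontK hpv
    (not_decomp_le_kerSubgroup_of_isCyclotomic κ hκ v)

end TameContinuous

section TrivialAction

/-! ## [P1] DISCHARGED to the two existing named facts in the RATIONAL-KERNEL case (generation 16)

For the FIRST isogeny of an `X₁`-class curve (`W(ℚ) ∋ P` of order `p`, `ψ₀ : W → W/⟨P⟩`) the kernel `M = ⟨P⟩ ≅ ℤ/p` carries the
TRIVIAL `Γ_ℚ`-action, `K(M) = K` is abelian over `ℚ`, and [P1] for `M` is literally Ferrero–Washington for `K`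
(`IwasawaTheory.ferreroWashington1979_classicalMuVanishes`) followed by Iwasawa's `μ = 0` in character form
(`IwasawaTheory.classicalMuVanishes_finite_unramifiedClasses`, trivial action): the dictionary is `mem_everywhereUnramified_iff`
(our `everywhereUnramified` = «all `Γ_K`-conjugates unramified at every finite place», the named fact's set verbatim). The general
`#M = p` case (a character `χ₀` of order dividing `p − 1`, `K(M) = K·ℚ(χ₀)`) is the typist route of memo §11.1 (prime-to-`p` restriction
`ZpExtension.restrict` to `F' = K(M)`, inflation–restriction, inertia compatibility) and stays displayed as `GL1InputUnramified`. -/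

open Field Literature.NumberTheory.EllipticCurves Literature.NumberTheory.EllipticCurves.GreenbergSelmer
  Literature.NumberTheory.GaloisRepresentations NumberField IsDedekindDomain Literature.NumberTheory.IwasawaTheory
  Literature.NumberTheory.EllipticCurves.GreenbergVatsal2000 Literature.NumberTheory.EllipticCurves.Castella2018

/-- An imaginary quadratic field is abelian over `ℚ` (quadratic ⟹ Galois with cyclic group). [folklore] -/
theorem isAbelianGalois_of_isImaginaryQuadratic (K : Type) [Field K] [NumberField K] (hK : IsImaginaryQuadratic K) :
    IsAbelianGalois ℚ K := by
  haveI : Algebra.IsQuadraticExtension ℚ K := ⟨hK.1⟩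
  exact IsAbelianGalois.of_isCyclic ℚ K

/-- **[P1] for a module with TRIVIAL `Γ_ℚ`-action, from the two named facts** (Ferrero–Washington for the abelian field `K`;
Iwasawa's `μ = 0` in character form): the everywhere-unramified classes of `H¹(K_∞, M)` are finite. This is [P1]
(`GL1InputUnramified`) restricted to the rational-kernel case `M = ⟨P⟩`, `P ∈ W(ℚ)[p]` — DISCHARGED, conditionally on exactly the two
displayed Literature facts (both theorems in print; neither kernel-proved: class field theory). [cite: FerreroWashington1979]
[cite: Koch1997, Chap. 4 §3.3 Thm. 4.36] [cite: Lang1990, Ch. 5 §4 pp. 137–143] -/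
theorem finite_everywhereUnramified_of_trivialAction
    (hFW : ferreroWashington1979_classicalMuVanishes) (hU : classicalMuVanishes_finite_unramifiedClasses)
    (K : Type) [Field K] [NumberField K] (hK : IsImaginaryQuadratic K) (p : ℕ) [Fact p.Prime] (hp2 : p ≠ 2)
    (κ : ZpExtension K p) (hκ : κ.IsCyclotomic)
    (M : Type) [AddCommGroup M] [DistribMulAction (absoluteGaloisGroup ℚ) M] [DistribMulAction (absoluteGaloisGroup K) M]
    [TopologicalSpace M] [DiscreteTopology M] (hcard : Nat.card M = p)
    (hprov : ∀ (σ : absoluteGaloisGroup K) (m : M), σ • m = (absGaloisRestrict ℚ K σ) • m)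
    (htriv : ∀ (τ : absoluteGaloisGroup ℚ) (m : M), τ • m = m) :
    ((everywhereUnramified κ.kerSubgroup M : AddSubgroup (subgroupH1 κ.kerSubgroup M)) :
        Set (subgroupH1 κ.kerSubgroup M)).Finite := by
  haveI := isAbelianGalois_of_isImaginaryQuadratic K hK
  haveI : Finite M := Nat.finite_of_card_ne_zero (by rw [hcard]; exact (Fact.out : p.Prime).ne_zero)
  have hodd : Odd p := (Fact.out : p.Prime).odd_of_ne_two hp2
  have htrivK : ∀ (σ : absoluteGaloisGroup K) (m : M), σ • m = m := fun σ m ↦ by rw [hprov, htriv]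
  have h := hU K p κ (Or.inl hodd) (hFW K p κ hκ) M ⟨1, by rw [hcard, pow_one]⟩ htrivK
  refine h.subset ?_
  intro c hc
  exact (mem_everywhereUnramified_iff c).1 hc

end TrivialAction

section ContinuousVariant

/-! ## (B3) for CONTINUOUS actions: road B junk-free, [P23] eliminated (generation 16)

Road B instantiates (B3) only at `M = E[ψ₀]`, a CONTINUOUS `Γ_K`-module (§ContBridge above:
`InterludeWithTorsion.kerSelmerMapFiniteOfDegreeP_of_residualCont : ResidualGL1FinitenessOddCont → KerSelmerMapFiniteOfDegreeP`). For continuous actions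
[P23] is the kernel theorem `finite_quotient_unramifiedAbove_of_continuous` (§TameContinuous), so
`ResidualGL1FinitenessOddCont ⟸ GL1InputUnramifiedCont ∧ GL1InputSplitPrimeCont`: road B's owed inputs are exactly the two classical
`μ = 0` statements for continuous characters of `Γ_K` of order dividing `p − 1` ([P1] Ferrero–Washington for `K(M)`; [Cv] Iwasawa 1973 +
Brumer–Leopoldt for `K(M)⁺`), with no junk case. The (B3)-shaped statements are WEAKER than their non-`Cont` versions
(`…Cont_of_…` below). Nothing is proved about (B3) itself. -/

open Field Literature.NumberTheory.EllipticCurves Literature.NumberTheory.EllipticCurves.GreenbergSelmer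
  Literature.NumberTheory.GaloisRepresentations NumberField IsDedekindDomain
  Literature.NumberTheory.EllipticCurves.GreenbergVatsal2000 Literature.NumberTheory.EllipticCurves.Castella2018

/-- **[P1] for continuous actions** (`GL1InputUnramified` with the extra antecedent «`Γ_K` acts continuously on `M`»). Displayed input:
Ferrero–Washington `μ = 0` in character form for the abelian field `K(M)`. [cite: FerreroWashington1979] [cite: Washington1997, §13.3] -/
@[conjecture] def GL1InputUnramifiedCont : Prop :=
  ∀ (K : Type) [Field K] [NumberField K], IsImaginaryQuadratic K →
    ∀ (p : ℕ) [Fact p.Prime], p ≠ 2 →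
    ∀ (κ : ZpExtension K p), κ.IsCyclotomic →
    ∀ (M : Type) [AddCommGroup M] [DistribMulAction (absoluteGaloisGroup ℚ) M]
      [DistribMulAction (absoluteGaloisGroup K) M] [TopologicalSpace M] [DiscreteTopology M],
      Nat.card M = p →
      (∀ (σ : absoluteGaloisGroup K) (m : M), σ • m = (absGaloisRestrict ℚ K σ) • m) →
      (∀ m : M, Continuous fun σ : absoluteGaloisGroup K ↦ σ • m) →
      ((everywhereUnramified κ.kerSubgroup M : AddSubgroup (subgroupH1 κ.kerSubgroup M)) :
        Set (subgroupH1 κ.kerSubgroup M)).Finite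

/-- **[Cv] for continuous actions** (`GL1InputSplitPrime` with the continuity antecedent). Displayed input: Iwasawa 1973 + Ferrero–Washington
for the even characters of `K(M)⁺`, Brumer–Leopoldt (Greenberg LNM 1716 pp. 143–144). [cite: GreenbergLNM1716, §5, pp. 143–144] -/
@[conjecture] def GL1InputSplitPrimeCont : Prop :=
  ∀ (K : Type) [Field K] [NumberField K], IsImaginaryQuadratic K →
    ∀ (p : ℕ) [Fact p.Prime], p ≠ 2 →
    ∀ (κ : ZpExtension K p), κ.IsCyclotomic →
    ∀ (v vbar : HeightOneSpectrum (𝓞 K)), ((p : ℕ) : 𝓞 K) ∈ v.asIdeal → ((p : ℕ) : 𝓞 K) ∈ vbar.asIdeal →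
      vbar ≠ v →
    ∀ (M : Type) [AddCommGroup M] [DistribMulAction (absoluteGaloisGroup ℚ) M]
      [DistribMulAction (absoluteGaloisGroup K) M] [TopologicalSpace M] [DiscreteTopology M],
      Nat.card M = p →
      (∀ (σ : absoluteGaloisGroup K) (m : M), σ • m = (absGaloisRestrict ℚ K σ) • m) →
      (∀ m : M, Continuous fun σ : absoluteGaloisGroup K ↦ σ • m) →
      Finite (GreenbergVatsal2000.datumStrictSelmer κ.kerSubgroup M p (AcSelmer.bdpData M p vbar) ∅ ⧸
        (everywhereUnramified κ.kerSubgroup M).addSubgroupOf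
          (GreenbergVatsal2000.datumStrictSelmer κ.kerSubgroup M p (AcSelmer.bdpData M p vbar) ∅))

/- (B3) for continuous actions = `InterludeWithTorsion.ResidualGL1FinitenessOddCont` (declared at the top of this file, next to the bridge
`kerSelmerMapFiniteOfDegreeP_of_residualCont`); its weakening from (B3) is `InterludeWithTorsion.residualGL1FinitenessOddCont_of_residualGL1FinitenessOdd`. -/

/-- [P1] ⟹ [P1] for continuous actions (weakening). [folklore] -/
theorem gl1InputUnramifiedCont_of (h : GL1InputUnramified) : GL1InputUnramifiedCont :=
  fun K _ _ hK p _ hp2 κ hκ M _ _ _ _ _ hcard hprov _ ↦ h K hK p hp2 κ hκ M hcard hprov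

/-- [Cv] ⟹ [Cv] for continuous actions (weakening). [folklore] -/
theorem gl1InputSplitPrimeCont_of (h : GL1InputSplitPrime) : GL1InputSplitPrimeCont :=
  fun K _ _ hK p _ hp2 κ hκ v vbar hpv hpvbar hne M _ _ _ _ _ hcard hprov _ ↦
    h K hK p hp2 κ hκ v vbar hpv hpvbar hne M hcard hprov

/-- **(B3) for continuous actions from [P1]-cont ∧ [Cv]-cont ALONE** — the tame input [P23] is the kernel theorem
`finite_quotient_unramifiedAbove_of_continuous`. [cite: GreenbergLNM1716, §5, pp. 143–144] [cite: GreenbergVatsal2000, §2 Prop. (2.4)] -/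
theorem residualGL1FinitenessOddCont_of_inputs (h₁ : GL1InputUnramifiedCont) (h₂ : GL1InputSplitPrimeCont) :
    ResidualGL1FinitenessOddCont := by
  intro K _ _ hK p _ hp2 κ hκ v vbar hpv hpvbar hne S hS M _ _ _ _ _ hcard hprov hcont
  refine finite_datumStrictSelmer_of_empty_of_tame κ.kerSubgroup M p (AcSelmer.bdpData M p vbar) S hS ?_ ?_
  · exact finite_datumStrictSelmer_empty_of_inputs κ.kerSubgroup M p (AcSelmer.bdpData M p vbar)
      (h₁ K hK p hp2 κ hκ M hcard hprov hcont) (h₂ K hK p hp2 κ hκ v vbar hpv hpvbar hne M hcard hprov hcont)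
  · intro u _ hpu
    exact finite_quotient_unramifiedAbove_of_continuous κ M hκ hcard hcont u hpu

/-- **(B3) for continuous actions in the rational-kernel case from the named facts + [Cv]-cont** (trivial `Γ_ℚ`-action).
[cite: FerreroWashington1979] [cite: GreenbergLNM1716, §5, pp. 143–144] -/
theorem residualGL1FinitenessOddCont_trivialAction_of_namedFacts
    (hFW : Literature.NumberTheory.IwasawaTheory.ferreroWashington1979_classicalMuVanishes)
    (hU : Literature.NumberTheory.IwasawaTheory.classicalMuVanishes_finite_unramifiedClasses) (h₂ : GL1InputSplitPrimeCont)
    (K : Type) [Field K] [NumberField K] (hK : IsImaginaryQuadratic K) (p : ℕ) [Fact p.Prime] (hp2 : p ≠ 2)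
    (κ : ZpExtension K p) (hκ : κ.IsCyclotomic)
    (v vbar : HeightOneSpectrum (𝓞 K)) (hpv : ((p : ℕ) : 𝓞 K) ∈ v.asIdeal) (hpvbar : ((p : ℕ) : 𝓞 K) ∈ vbar.asIdeal)
    (hne : vbar ≠ v) (S : Set (HeightOneSpectrum (𝓞 K))) (hS : S.Finite)
    (M : Type) [AddCommGroup M] [DistribMulAction (absoluteGaloisGroup ℚ) M] [DistribMulAction (absoluteGaloisGroup K) M]
    [TopologicalSpace M] [DiscreteTopology M] (hcard : Nat.card M = p)
    (hprov : ∀ (σ : absoluteGaloisGroup K) (m : M), σ • m = (absGaloisRestrict ℚ K σ) • m)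
    (htriv : ∀ (τ : absoluteGaloisGroup ℚ) (m : M), τ • m = m) :
    (GreenbergVatsal2000.datumStrictSelmer κ.kerSubgroup M p (AcSelmer.bdpData M p vbar) S :
        Set (subgroupH1 κ.kerSubgroup M)).Finite := by
  have htrivK : ∀ (σ : absoluteGaloisGroup K) (m : M), σ • m = m := fun σ m ↦ by rw [hprov, htriv]
  have hcont : ∀ m : M, Continuous fun σ : absoluteGaloisGroup K ↦ σ • m := fun m ↦ by
    have : (fun σ : absoluteGaloisGroup K ↦ σ • m) = fun _ ↦ m := funext fun σ ↦ htrivK σ m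
    rw [this]
    exact continuous_const
  refine finite_datumStrictSelmer_of_empty_of_tame κ.kerSubgroup M p (AcSelmer.bdpData M p vbar) S hS ?_ ?_
  · exact finite_datumStrictSelmer_empty_of_inputs κ.kerSubgroup M p (AcSelmer.bdpData M p vbar)
      (finite_everywhereUnramified_of_trivialAction hFW hU K hK p hp2 κ hκ M hcard hprov htriv)
      (h₂ K hK p hp2 κ hκ v vbar hpv hpvbar hne M hcard hprov hcont)
  · intro u _ hpu
    exact finite_quotient_unramifiedAbove_of_continuous κ M hκ hcard hcont u hpu

/-- **(B3) for continuous actions, RATIONAL-KERNEL CASE** (`ResidualGL1FinitenessOddCont` restricted to a TRIVIAL `Γ_ℚ`-action on `M`: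
the module `E[ψ₀] = ⟨P⟩ ≅ ℤ/p` of the first isogeny of an `X₁(p)`-class). Stated as a named obligation so that its CONDITIONAL PROOF
below (`residualGL1FinitenessOddContRat_of_namedFacts`: from the named facts Ferrero–Washington + Iwasawa `μ = 0 ⇒` finite unramified
classes, and [Cv]-cont) is visible to the audit. [cite: FerreroWashington1979] [cite: GreenbergLNM1716, §5, pp. 143–144] -/
@[conjecture] def ResidualGL1FinitenessOddContRat : Prop :=
  ∀ (K : Type) [Field K] [NumberField K], IsImaginaryQuadratic K →
    ∀ (p : ℕ) [Fact p.Prime], p ≠ 2 →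
    ∀ (κ : ZpExtension K p), κ.IsCyclotomic →
    ∀ (v vbar : HeightOneSpectrum (𝓞 K)), ((p : ℕ) : 𝓞 K) ∈ v.asIdeal → ((p : ℕ) : 𝓞 K) ∈ vbar.asIdeal →
      vbar ≠ v →
    ∀ (S : Set (HeightOneSpectrum (𝓞 K))), S.Finite →
    ∀ (M : Type) [AddCommGroup M] [DistribMulAction (absoluteGaloisGroup ℚ) M]
      [DistribMulAction (absoluteGaloisGroup K) M] [TopologicalSpace M] [DiscreteTopology M],
      Nat.card M = p →
      (∀ (σ : absoluteGaloisGroup K) (m : M), σ • m = (absGaloisRestrict ℚ K σ) • m) →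
      (∀ (τ : absoluteGaloisGroup ℚ) (m : M), τ • m = m) →
      (GreenbergVatsal2000.datumStrictSelmer κ.kerSubgroup M p (AcSelmer.bdpData M p vbar) S :
        Set (subgroupH1 κ.kerSubgroup M)).Finite

/-- (B3)-cont ⟹ its rational-kernel case (a trivial action is continuous). [folklore] -/
theorem residualGL1FinitenessOddContRat_of_cont (h : ResidualGL1FinitenessOddCont) : ResidualGL1FinitenessOddContRat := by
  intro K _ _ hK p _ hp2 κ hκ v vbar hpv hpvbar hne S hS M _ _ _ _ _ hcard hprov htriv
  have hcont : ∀ m : M, Continuous fun σ : absoluteGaloisGroup K ↦ σ • m := fun m ↦ by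
    have : (fun σ : absoluteGaloisGroup K ↦ σ • m) = fun _ ↦ m := funext fun σ ↦ by rw [hprov, htriv]
    rw [this]
    exact continuous_const
  exact h K hK p hp2 κ hκ v vbar hpv hpvbar hne S hS M hcard hprov hcont

/-- **The rational-kernel case of (B3)-cont from the NAMED FACTS + [Cv]-cont** (no [P1], no [P23] input).
[cite: FerreroWashington1979] [cite: GreenbergLNM1716, §5, pp. 143–144] -/
theorem residualGL1FinitenessOddContRat_of_namedFacts
    (hFW : Literature.NumberTheory.IwasawaTheory.ferreroWashington1979_classicalMuVanishes)
    (hU : Literature.NumberTheory.IwasawaTheory.classicalMuVanishes_finite_unramifiedClasses) (h₂ : GL1InputSplitPrimeCont) :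
    ResidualGL1FinitenessOddContRat :=
  fun K _ _ hK p _ hp2 κ hκ v vbar hpv hpvbar hne S hS M _ _ _ _ _ hcard hprov htriv ↦
    residualGL1FinitenessOddCont_trivialAction_of_namedFacts hFW hU h₂ K hK p hp2 κ hκ v vbar hpv hpvbar hne S hS M hcard hprov htriv

end ContinuousVariant

end Summit.BirchSwinnertonDyer.BirchSwinnertonDyer.Theorems.InterludeWithTorsion.RoadBHelpers

end
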